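import Literature.Computability.Complexity.NegacyclicFFTBreadthFirst
import HarnessLib

/-!
# The plan of the breadth-first negacyclic multiplier: levels, schedule, validity

Literature / complexity toolkit, continuing `NegacyclicFFTBreadthFirst.lean`.  The stack machine
that runs `negMulRec` (`NegacyclicFFT.lean`) is a sequence of loops: the DESCENTS (digits + the
`⌊k/2⌋` forward levels, one batch pass each), the schoolbook products of the leaves, and the
ASCENTS (the `⌊k/2⌋` inverse levels, then overlap-add).  This file is the list-level bookkeeping
the machine proofs are checked against, all fully proved:

* validity of the pair functions `gF₁ gF₂ gI₁ gI₂` (`valid_of_len_mod`, `gF₁_valid`, …);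
* the descents as data: `ditems k B` (the pairs `(k_i, B_i)` of exponent and batch size, in
  descent order), the leaf exponent / batch size / batches `kfin`, `Bfin`, `dAll`, the ascents
  `ascAll`, and **`bfRec_eq_plan`**: `bfRec = ascAll ∘ (products of the leaves of dAll)`;
* the twiddle lists `twAt` level by level (`twAt_facts`: multiples of `2^{a+1-j}`, positive,
  `< 4m`; `twAt_hFs`: the level-pass side conditions), the per-depth history `twHist`;
* `chunks_facts`;
* one descent level by level: `dForest`, `dLevel` with **`levelOut_dLevel`** (a forward level
  pass is one more level), **`dLevel_last`** (`= descOne`), `length_dLevel`, `dLevel_valid`;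
* one ascent height by height: `aLevel` with **`levelOut_aLevel`** (an inverse level pass with
  the PARENT twiddles is one more merge height), **`aLevel_last`** (chunkwise `invN`),
  `length_aLevel`, `aLevel_valid`, `aChunks_facts`, `ascOne_facts`, `descOne_facts`;
* the schedule and history after the descents `schedFin`, `histFin` and their closed forms
  (`schedFin_eq`, `histFin_eq` via `aHist`, `twEnc`), `dAll_facts`, the ascent well-formedness
  predicate `AscWF` with **`ascWF_ditems`**, the descent test coding `kdCode_ditems`, and
  `leaf_facts`.

## References

* J. von zur Gathen, J. Gerhard, *Modern Computer Algebra*, 3rd ed., CUP 2013, §8.3 Alg. 8.20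
  (Schönhage–Strassen), §8.2 (the butterfly network level by level).
* D. G. Cantor, E. Kaltofen, On fast multiplication of polynomials over arbitrary algebras,
  *Acta Inform.* 28 (1991) 693–701. (Folklore material, fully proved here.)
-/

namespace Literature.Computability.Complexity

namespace NegFFT

open _root_.Computability

variable (N : ℕ)

/-! ### Validity of the block operations -/

section Valid

variable {N}

/-- A block operation's output is valid when it has length `2m` and reduced entries; in the
degenerate case `N = 0` the inputs are empty. [folklore] -/
theorem valid_of_len_mod {N m : ℕ} {u r : List ℕ} (hu : u.length = 2 * m ∧ ∀ a ∈ u, a < N) (hr : r.length = 2 * m)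
    (hmod : 0 < N → ∀ a ∈ r, a < N) : r.length = 2 * m ∧ ∀ a ∈ r, a < N := by
  refine ⟨hr, fun a ha => ?_⟩
  rcases Nat.eq_zero_or_pos N with hN | hN
  · exfalso
    rcases u with _ | ⟨b, _⟩
    · have : r = [] := List.eq_nil_of_length_eq_zero (by rw [hr]; simpa using hu.1.symm)
      rw [this] at ha; simp at ha
    · have := hu.2 b (by simp); omega
  · exact hmod hN a ha

/-- `gF₁` preserves validity. [folklore] -/
theorem gF₁_valid (N m : ℕ) : ∀ (E : ℕ) (u w : List ℕ), (u.length = 2 * m ∧ ∀ a ∈ u, a < N) → (w.length = 2 * m ∧ ∀ a ∈ w, a < N) →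
    (gF₁ N m E u w).length = 2 * m ∧ ∀ a ∈ gF₁ N m E u w, a < N := fun E u w hu hw =>
  valid_of_len_mod hu (by rw [gF₁, length_vaddMod, length_negShift hw.1, hu.1, min_self]) fun hN _ ha => lt_of_mem_vaddMod hN ha

/-- `gF₂` preserves validity. [folklore] -/
theorem gF₂_valid (N m : ℕ) : ∀ (E : ℕ) (u w : List ℕ), (u.length = 2 * m ∧ ∀ a ∈ u, a < N) → (w.length = 2 * m ∧ ∀ a ∈ w, a < N) →
    (gF₂ N m E u w).length = 2 * m ∧ ∀ a ∈ gF₂ N m E u w, a < N := fun E u w hu hw =>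
  valid_of_len_mod hu (by rw [gF₂, length_vsubMod, length_negShift hw.1, hu.1, min_self]) fun hN _ ha => lt_of_mem_vsubMod hN ha

/-- `gI₁` preserves validity. [folklore] -/
theorem gI₁_valid (N m : ℕ) : ∀ (E : ℕ) (u w : List ℕ), (u.length = 2 * m ∧ ∀ a ∈ u, a < N) → (w.length = 2 * m ∧ ∀ a ∈ w, a < N) →
    (gI₁ N E u w).length = 2 * m ∧ ∀ a ∈ gI₁ N E u w, a < N := fun E u w hu hw =>
  valid_of_len_mod hu (by rw [gI₁, length_vscaleMod, length_vaddMod, hu.1, hw.1, min_self]) fun hN _ ha => lt_of_mem_vscaleMod hN ha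

/-- `gI₂` preserves validity. [folklore] -/
theorem gI₂_valid (N m : ℕ) : ∀ (E : ℕ) (u w : List ℕ), (u.length = 2 * m ∧ ∀ a ∈ u, a < N) → (w.length = 2 * m ∧ ∀ a ∈ w, a < N) →
    (gI₂ N m E u w).length = 2 * m ∧ ∀ a ∈ gI₂ N m E u w, a < N := fun E u w hu hw => by
  have hl : (vscaleMod N (inv2N N) (vsubMod N u w)).length = 2 * m := by rw [length_vscaleMod, length_vsubMod, hu.1, hw.1, min_self]
  exact valid_of_len_mod hu (by rw [gI₂, length_negShift hl]) fun hN _ ha =>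
    lt_of_mem_negShift hN (fun b hb => lt_of_mem_vscaleMod hN hb) ha

end Valid

/-! ### The descent items and the leaf data -/

/-- The descents of the recursion from exponent `k` with `B` instances: the pairs
`(k_i, B_i)` (exponent and batch size at depth `i`), in descent order. [folklore] -/
def ditems : ℕ → ℕ → List (ℕ × ℕ)
  | k, B => if k ≤ 3 then [] else (k, B) :: ditems ((k + 1) / 2 + 1) (B * 2 ^ (k / 2))
  termination_by k => k
  decreasing_by omega

/-- The leaf exponent. [folklore] -/
def kfin : ℕ → ℕ
  | k => if k ≤ 3 then k else kfin ((k + 1) / 2 + 1)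
  termination_by k => k
  decreasing_by omega

/-- The leaf batch size. [folklore] -/
def Bfin : ℕ → ℕ → ℕ
  | k, B => if k ≤ 3 then B else Bfin ((k + 1) / 2 + 1) (B * 2 ^ (k / 2))
  termination_by k => k
  decreasing_by omega

/-- The leaf batch: all descents applied. [folklore] -/
def dAll : ℕ → List (List ℕ) → List (List ℕ)
  | k, Fb => if k ≤ 3 then Fb else dAll ((k + 1) / 2 + 1) (descOne N k Fb)
  termination_by k => k
  decreasing_by omega

/-- The ascents along a list of items (leaf first). [folklore] -/
def ascAll (L : List (ℕ × ℕ)) (M : List (List ℕ)) : List (List ℕ) := L.foldl (fun M p => ascOne N p.1 M) M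

/-- `ditems` unfolds at `k ≥ 4`. [folklore] -/
theorem ditems_of_gt {k : ℕ} (hk : 3 < k) (B : ℕ) : ditems k B = (k, B) :: ditems ((k + 1) / 2 + 1) (B * 2 ^ (k / 2)) := by
  rw [ditems, if_neg (by omega)]

/-- `ditems` is empty at `k ≤ 3`. [folklore] -/
theorem ditems_of_le {k : ℕ} (hk : k ≤ 3) (B : ℕ) : ditems k B = [] := by
  rw [ditems, if_pos hk]

/-- Every descent item has exponent `≥ 4`. [folklore] -/
theorem ditems_gt (k : ℕ) : ∀ (B : ℕ), ∀ p ∈ ditems k B, 3 < p.1 ∧ p.1 ≤ k := by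
  induction k using Nat.strong_induction_on with
  | _ k ih =>
    intro B p hp
    rw [ditems] at hp
    split_ifs at hp with hk
    · simp at hp
    · rw [List.mem_cons] at hp
      rcases hp with rfl | hp
      · exact ⟨by omega, le_rfl⟩
      · have := ih _ (by omega) _ p hp; omega

/-- The leaf exponent is at most `k`. [folklore] -/
theorem kfin_le_self (k : ℕ) : kfin k ≤ k := by
  induction k using Nat.strong_induction_on with
  | _ k ih =>
    rw [kfin]
    split_ifs with hk
    · exact le_rfl
    · exact (ih _ (by omega)).trans (by omega)

/-- The leaf exponent is at most `3`. [folklore] -/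
theorem kfin_le_three (k : ℕ) : kfin k ≤ 3 := by
  induction k using Nat.strong_induction_on with
  | _ k ih =>
    rw [kfin]
    split_ifs with hk
    · exact hk
    · exact ih _ (by omega)

/-- `kfin` at `k ≤ 3`. [folklore] -/
theorem kfin_of_le {k : ℕ} (hk : k ≤ 3) : kfin k = k := by rw [kfin, if_pos hk]

/-- `kfin` at `k ≥ 4`. [folklore] -/
theorem kfin_of_gt {k : ℕ} (hk : 3 < k) : kfin k = kfin ((k + 1) / 2 + 1) := by rw [kfin, if_neg (by omega)]

/-- `Bfin` at `k ≤ 3`. [folklore] -/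
theorem Bfin_of_le {k : ℕ} (hk : k ≤ 3) (B : ℕ) : Bfin k B = B := by rw [Bfin, if_pos hk]

/-- `Bfin` at `k ≥ 4`. [folklore] -/
theorem Bfin_of_gt {k : ℕ} (hk : 3 < k) (B : ℕ) : Bfin k B = Bfin ((k + 1) / 2 + 1) (B * 2 ^ (k / 2)) := by rw [Bfin, if_neg (by omega)]

/-- `dAll` at `k ≤ 3`. [folklore] -/
theorem dAll_of_le {k : ℕ} (hk : k ≤ 3) (Fb : List (List ℕ)) : dAll N k Fb = Fb := by rw [dAll, if_pos hk]

/-- `dAll` at `k ≥ 4`. [folklore] -/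
theorem dAll_of_gt {k : ℕ} (hk : 3 < k) (Fb : List (List ℕ)) : dAll N k Fb = dAll N ((k + 1) / 2 + 1) (descOne N k Fb) := by
  rw [dAll, if_neg (by omega)]

/-- **The plan computes `bfRec`**: descend along `ditems`, multiply the leaves, ascend back. [folklore] -/
theorem bfRec_eq_plan (k : ℕ) : ∀ (B : ℕ) (Fb Gb : List (List ℕ)),
    bfRec N k Fb Gb = ascAll N (ditems k B).reverse (List.zipWith (negMul N (2 ^ kfin k)) (dAll N k Fb) (dAll N k Gb)) := by
  induction k using Nat.strong_induction_on with
  | _ k ih =>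
    intro B Fb Gb
    rw [bfRec]
    split_ifs with hk
    · rw [ditems_of_le hk, kfin_of_le hk, dAll_of_le N hk, dAll_of_le N hk]; simp [ascAll]
    · have hk' : 3 < k := by omega
      rw [ditems_of_gt hk', kfin_of_gt hk', dAll_of_gt N hk', dAll_of_gt N hk', ih _ (by omega) (B * 2 ^ (k / 2)),
        List.reverse_cons, ascAll, ascAll, List.foldl_append, List.foldl_cons, List.foldl_nil]

/-! ### Twiddle lists -/

/-- Length of the twiddle list of level `j`. [folklore] -/
theorem length_twAt (m F B : ℕ) : ∀ j, (twAt m F B j).length = B * 2 ^ j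
  | 0 => by simp [twAt]
  | j + 1 => by rw [twAt, Function.iterate_succ_apply', ← twAt, length_childTw, length_twAt m F B j, pow_succ]; ring

/-- The next level's twiddles are the children. [folklore] -/
theorem twAt_succ (m F B j : ℕ) : twAt m F B (j + 1) = childTw m (twAt m F B j) := by
  rw [twAt, Function.iterate_succ_apply', ← twAt]

/-- The twiddles of level `j ≤ a` of trees rooted at `2m`, `m = 2^a`: multiples of
`2^{a+1-j}`, positive, below `4m`. [folklore] -/
theorem twAt_facts (a B : ℕ) : ∀ j, j ≤ a → ∀ F ∈ twAt (2 ^ a) (2 * 2 ^ a) B j, 2 ^ (a + 1 - j) ∣ F ∧ 0 < F ∧ F < 4 * 2 ^ a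
  | 0, _, F, hF => by
    simp only [twAt, Function.iterate_zero, id_eq, List.mem_replicate] at hF
    obtain ⟨-, rfl⟩ := hF
    refine ⟨by rw [Nat.sub_zero, pow_succ, mul_comm], by positivity, by have := Nat.two_pow_pos a; omega⟩
  | j + 1, hj, F, hF => by
    rw [twAt_succ, childTw, List.mem_flatMap] at hF
    obtain ⟨F', hF', hF⟩ := hF
    obtain ⟨hdvd, hpos, hlt⟩ := twAt_facts a B j (by omega) F' hF'
    have he : a + 1 - j = (a - j) + 1 := by omega
    rw [he, pow_succ] at hdvd
    have h2 : 2 ^ (a - j) ∣ F' / 2 := by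
      obtain ⟨c, hc⟩ := hdvd
      exact ⟨c, by rw [hc, show 2 ^ (a - j) * 2 * c = 2 ^ (a - j) * c * 2 by ring, Nat.mul_div_cancel _ two_pos]⟩
    have h2m : 2 ^ (a - j) ∣ 2 * 2 ^ a := by
      rw [← pow_succ']; exact pow_dvd_pow 2 (by omega)
    have hF'2 : 2 ≤ F' := by
      obtain ⟨c, hc⟩ := hdvd
      rcases Nat.eq_zero_or_pos c with rfl | hc0
      · simp at hc; omega
      · have : 1 ≤ 2 ^ (a - j) := Nat.one_le_two_pow; nlinarith
    simp only [List.mem_cons, List.not_mem_nil, or_false] at hF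
    rw [show a + 1 - (j + 1) = a - j by omega]
    rcases hF with rfl | rfl
    · exact ⟨h2, by omega, by omega⟩
    · exact ⟨Nat.dvd_add h2 h2m, by omega, by omega⟩

/-- The level-pass form of the twiddle conditions, at levels `j < a`. [folklore] -/
theorem twAt_hFs (a B : ℕ) {j : ℕ} (hj : j < a) :
    ∀ F ∈ twAt (2 ^ a) (2 * 2 ^ a) B j, F = 2 * (F / 2) ∧ 1 ≤ F / 2 ∧ F / 2 < 4 * 2 ^ a := by
  intro F hF
  obtain ⟨hdvd, hpos, hlt⟩ := twAt_facts a B j hj.le F hF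
  have h2 : 2 ∣ F := (dvd_pow_self 2 (by omega : a + 1 - j ≠ 0)).trans hdvd
  refine ⟨?_, ?_, ?_⟩ <;> omega

/-- The items of the twiddle history of one depth, most recent level first:
`[twAt (s-1), …, twAt 0]`. [folklore] -/
def twHist (m F B s : ℕ) : List (List ℕ) := ((List.range s).map (twAt m F B)).reverse

/-- One more level on the history. [folklore] -/
theorem twHist_succ (m F B s : ℕ) : twHist m F B (s + 1) = twAt m F B s :: twHist m F B s := by
  simp [twHist, List.range_succ]

/-- The empty history. [folklore] -/
@[simp] theorem twHist_zero (m F B : ℕ) : twHist m F B 0 = [] := by simp [twHist]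

/-! ### Chunks -/

/-- Chunks of a list whose length is a multiple of `t ≥ 1`: all of length `t`, `|L|/t` of them,
concatenating to `L`. [folklore] -/
theorem chunks_facts {α : Type*} {t : ℕ} (ht : 0 < t) : ∀ (L : List α), t ∣ L.length →
    (∀ C ∈ chunks t L, C.length = t) ∧ (chunks t L).length = L.length / t ∧ (chunks t L).flatten = L ∧
      ∀ C ∈ chunks t L, ∀ x ∈ C, x ∈ L
  | [], _ => by simp [chunks]
  | a :: l, hdl => by
    have hle : t ≤ (a :: l).length := Nat.le_of_dvd (by simp) hdl
    have hdl' : t ∣ ((a :: l).drop t).length := by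
      rw [List.length_drop]; exact Nat.dvd_sub hdl dvd_rfl
    have hlt : ((a :: l).drop t).length < (a :: l).length := by rw [List.length_drop]; simp at hle ⊢; omega
    obtain ⟨h1, h2, h3, h4⟩ := chunks_facts ht ((a :: l).drop t) hdl'
    rw [chunks, if_neg (by omega)]
    refine ⟨?_, ?_, ?_, ?_⟩
    · intro C hC
      rw [List.mem_cons] at hC
      rcases hC with rfl | hC
      · rw [List.length_take]; omega
      · exact h1 C hC
    · rw [List.length_cons, h2, List.length_drop]
      obtain ⟨c, hc⟩ := hdl
      rw [hc, show t * c - t = t * (c - 1) by rw [Nat.mul_sub, mul_one], Nat.mul_div_cancel_left _ ht, Nat.mul_div_cancel_left _ ht]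
      have : 1 ≤ c := by
        rcases Nat.eq_zero_or_pos c with h0 | h0
        · subst h0; simp at hc
        · exact h0
      omega
    · rw [List.flatten_cons, h3, List.take_append_drop]
    · intro C hC x hx
      rw [List.mem_cons] at hC
      rcases hC with rfl | hC
      · exact List.mem_of_mem_take hx
      · exact List.mem_of_mem_drop (h4 C hC x hx)
  termination_by L => L.length

/-! ### One descent, level by level -/

section Descent

variable (k : ℕ) (Fb : List (List ℕ))

/-- The forest of one descent at exponent `k`: instance `f` rooted at twiddle `2m` with its digits. [folklore] -/
def dForest : List (ℕ × List (List ℕ)) :=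
  Fb.map fun f => (2 * 2 ^ ((k + 1) / 2), digits (2 ^ ((k + 1) / 2)) (2 ^ (k / 2)) f)

/-- The batch after `j` forward levels of the descent at exponent `k`. [folklore] -/
def dLevel (j : ℕ) : List (List ℕ) := ((stepN N (2 ^ ((k + 1) / 2)))^[j] (dForest k Fb)).flatMap Prod.snd

/-- The roots of the forest. [folklore] -/
theorem map_fst_dForest : (dForest k Fb).map Prod.fst = List.replicate Fb.length (2 * 2 ^ ((k + 1) / 2)) := by
  rw [dForest, List.map_map, Function.comp_def]; exact List.map_const'

/-- The twiddles after `j` levels are `twAt … j`. [folklore] -/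
theorem map_fst_iterate_stepN (j : ℕ) :
    ((stepN N (2 ^ ((k + 1) / 2)))^[j] (dForest k Fb)).map Prod.fst = twAt (2 ^ ((k + 1) / 2)) (2 * 2 ^ ((k + 1) / 2)) Fb.length j := by
  induction j with
  | zero => simp [twAt, map_fst_dForest]
  | succ j ih => rw [Function.iterate_succ_apply', map_fst_stepN, ih, twAt_succ]

/-- Block counts along the levels: every tree of level `j ≤ lv` has `2^{lv-j}` blocks. [folklore] -/
theorem length_snd_iterate_stepN : ∀ (j : ℕ), j ≤ k / 2 →
    ∀ p ∈ (stepN N (2 ^ ((k + 1) / 2)))^[j] (dForest k Fb), p.2.length = 2 ^ (k / 2 - j)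
  | 0, _, p, hp => by
    simp only [Function.iterate_zero, id_eq, dForest, List.mem_map] at hp
    obtain ⟨f, -, rfl⟩ := hp
    simp
  | j + 1, hj, p, hp => by
    rw [Function.iterate_succ_apply'] at hp
    have := length_snd_stepN (h := 2 ^ (k / 2 - (j + 1)))
      (fun p' hp' => by rw [length_snd_iterate_stepN j (by omega) p' hp', ← pow_succ']; congr 1; omega) p hp
    exact this

/-- Level `0` is the digitized batch. [folklore] -/
theorem dLevel_zero : dLevel N k Fb 0 = Fb.flatMap (digits (2 ^ ((k + 1) / 2)) (2 ^ (k / 2))) := by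
  simp [dLevel, dForest, List.flatMap_map]

/-- **One forward level pass is one more level.** [folklore] -/
theorem levelOut_dLevel {j : ℕ} (hj : j < k / 2) :
    levelOut (gF₁ N (2 ^ ((k + 1) / 2))) (gF₂ N (2 ^ ((k + 1) / 2))) (2 ^ (k / 2 - (j + 1)))
      (twAt (2 ^ ((k + 1) / 2)) (2 * 2 ^ ((k + 1) / 2)) Fb.length j) (dLevel N k Fb j) = dLevel N k Fb (j + 1) := by
  rw [← map_fst_iterate_stepN N, dLevel, dLevel, Function.iterate_succ_apply']
  exact levelOut_gF_eq_stepN _ (fun p hp => by rw [length_snd_iterate_stepN N k Fb j hj.le p hp, ← pow_succ']; congr 1; omega)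

/-- **After all `k/2` levels the batch is the descent `descOne`.** [folklore] -/
theorem dLevel_last : dLevel N k Fb (k / 2) = descOne N k Fb := by
  rw [dLevel, flatMap_iterate_stepN _ _ (fun p hp => by rw [length_snd_iterate_stepN N k Fb 0 (Nat.zero_le _) p hp, Nat.sub_zero]),
    dForest, List.flatMap_map, descOne]

/-- Length of a level. [folklore] -/
theorem length_dLevel {j : ℕ} (hj : j ≤ k / 2) : (dLevel N k Fb j).length = Fb.length * 2 ^ (k / 2) := by
  rw [dLevel, List.length_flatMap]
  have hl := length_snd_iterate_stepN N k Fb j hj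
  rw [List.map_congr_left hl, List.map_const', List.sum_replicate, smul_eq_mul, ← List.length_map (f := Prod.fst),
    map_fst_iterate_stepN N, length_twAt, mul_assoc, ← pow_add]
  congr 2; omega

/-- Validity along the levels (for `N > 0`). [folklore] -/
theorem dLevel_valid (hN : 0 < N) (hFb : ∀ b ∈ Fb, BlockOK N (2 ^ k) b) : ∀ (j : ℕ), j ≤ k / 2 →
    ∀ b ∈ dLevel N k Fb j, b.length = 2 * 2 ^ ((k + 1) / 2) ∧ ∀ a ∈ b, a < N
  | 0, _, b, hb => by
    rw [dLevel_zero, List.mem_flatMap] at hb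
    obtain ⟨f, hf, hb⟩ := hb
    exact blockOK_digits (m := 2 ^ ((k + 1) / 2)) (t := 2 ^ (k / 2)) (by rw [← two_pow_split]; exact hFb f hf) hN b hb
  | j + 1, hj, b, hb => by
    rw [← levelOut_dLevel N k Fb (by omega)] at hb
    exact levelOut_valid (gF₁_valid N _) (gF₂_valid N _) _ _ _ (dLevel_valid hN hFb j (by omega)) b hb

end Descent

/-! ### One ascent, level by level -/

section Ascent

variable (k B : ℕ) (M : List (List ℕ))

/-- The results after `r` inverse levels of the ascent at exponent `k` (`B` instances, leaf
products `M`): the inverted batch at merge height `r`, over the twiddles of level `k/2 - r`. [folklore] -/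
def aLevel (r : ℕ) : List (List ℕ) :=
  invBatch N (2 ^ ((k + 1) / 2)) r (twAt (2 ^ ((k + 1) / 2)) (2 * 2 ^ ((k + 1) / 2)) B (k / 2 - r)) M

/-- Height `0` is the leaf list. [folklore] -/
theorem aLevel_zero (hM : M.length = B * 2 ^ (k / 2)) : aLevel N k B M 0 = M :=
  invBatch_zero _ _ (by rw [length_twAt, hM, Nat.sub_zero])

/-- **One inverse level pass is one more merge height** (with the parent twiddles). [folklore] -/
theorem levelOut_aLevel {r : ℕ} (hr : r < k / 2) (hM : M.length = B * 2 ^ (k / 2)) :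
    levelOut (gI₁ N) (gI₂ N (2 ^ ((k + 1) / 2))) (2 ^ r) (twAt (2 ^ ((k + 1) / 2)) (2 * 2 ^ ((k + 1) / 2)) B (k / 2 - (r + 1)))
      (aLevel N k B M r) = aLevel N k B M (r + 1) := by
  rw [aLevel, aLevel, show k / 2 - r = k / 2 - (r + 1) + 1 by omega, twAt_succ]
  refine levelOut_gI_invBatch r _ M ?_
  rw [length_twAt, hM, mul_assoc, ← pow_add]; congr 2; omega

/-- **After all `k/2` heights the results are the chunkwise inverse transforms.** [folklore] -/
theorem aLevel_last (hM : M.length = B * 2 ^ (k / 2)) :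
    aLevel N k B M (k / 2) = ((chunks (2 ^ (k / 2)) M).map fun C => invN N (2 ^ ((k + 1) / 2)) (2 * 2 ^ ((k + 1) / 2)) (k / 2) C).flatten := by
  rw [aLevel, Nat.sub_self, twAt, Function.iterate_zero, id_eq]
  exact invBatch_replicate _ _ B M hM

/-- Length along the heights. [folklore] -/
theorem length_aLevel (hM : M.length = B * 2 ^ (k / 2)) {r : ℕ} (hr : r ≤ k / 2) : (aLevel N k B M r).length = B * 2 ^ (k / 2) := by
  have e : B * 2 ^ (k / 2) = (twAt (2 ^ ((k + 1) / 2)) (2 * 2 ^ ((k + 1) / 2)) B (k / 2 - r)).length * 2 ^ r := by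
    rw [length_twAt, mul_assoc, ← pow_add]; congr 2; omega
  rw [aLevel, length_invBatch r _ M (by rw [hM, e]), ← e]

/-- Validity along the heights. [folklore] -/
theorem aLevel_valid (hM : M.length = B * 2 ^ (k / 2)) (hMv : ∀ b ∈ M, b.length = 2 * 2 ^ ((k + 1) / 2) ∧ ∀ a ∈ b, a < N) :
    ∀ (r : ℕ), r ≤ k / 2 → ∀ b ∈ aLevel N k B M r, b.length = 2 * 2 ^ ((k + 1) / 2) ∧ ∀ a ∈ b, a < N
  | 0, _, b, hb => by rw [aLevel_zero N k B M hM] at hb; exact hMv b hb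
  | r + 1, hr, b, hb => by
    rw [← levelOut_aLevel N k B M (by omega) hM] at hb
    exact levelOut_valid (gI₁_valid N _) (gI₂_valid N _) _ _ _ (aLevel_valid hM hMv r (by omega)) b hb

/-- The chunks of the leaf list, inverse transformed: the overlap-add inputs. [folklore] -/
def aChunks : List (List (List ℕ)) :=
  (chunks (2 ^ (k / 2)) M).map fun C => invN N (2 ^ ((k + 1) / 2)) (2 * 2 ^ ((k + 1) / 2)) (k / 2) C

/-- The overlap-add of the chunks is the ascent. [folklore] -/
theorem map_overlapAdd_aChunks : (aChunks N k M).map (overlapAdd N (2 ^ ((k + 1) / 2))) = ascOne N k M := by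
  rw [aChunks, List.map_map]; rfl

/-- The chunks: `B` of them, each of `2^{k/2}` valid blocks, concatenating to the last height. [folklore] -/
theorem aChunks_facts (hM : M.length = B * 2 ^ (k / 2)) (hMv : ∀ b ∈ M, b.length = 2 * 2 ^ ((k + 1) / 2) ∧ ∀ a ∈ b, a < N) :
    (aChunks N k M).flatten = aLevel N k B M (k / 2) ∧ (aChunks N k M).length = B ∧
      ∀ C ∈ aChunks N k M, C.length = 2 ^ (k / 2) ∧ ∀ b ∈ C, b.length = 2 * 2 ^ ((k + 1) / 2) ∧ ∀ a ∈ b, a < N := by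
  obtain ⟨h1, h2, h3, h4⟩ := chunks_facts (Nat.two_pow_pos (k / 2)) M (by rw [hM]; exact dvd_mul_left _ _)
  have hfl : (aChunks N k M).flatten = aLevel N k B M (k / 2) := by rw [aLevel_last N k B M hM, aChunks]
  refine ⟨hfl, by rw [aChunks, List.length_map, h2, hM, Nat.mul_div_cancel _ (Nat.two_pow_pos _)], fun C hC => ⟨?_, fun b hb => ?_⟩⟩
  · rw [aChunks, List.mem_map] at hC
    obtain ⟨C', hC', rfl⟩ := hC
    exact length_invN _ _ (h1 C' hC')
  · have hb' : b ∈ aLevel N k B M (k / 2) := by rw [← hfl, List.mem_flatten]; exact ⟨C, hC, hb⟩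
    exact aLevel_valid N k B M hM hMv _ le_rfl b hb'

/-- **Validity and size of an ascent** (for `N > 0`). [folklore] -/
theorem ascOne_facts (hN : 0 < N) (hM : M.length = B * 2 ^ (k / 2))
    (hMv : ∀ b ∈ M, b.length = 2 * 2 ^ ((k + 1) / 2) ∧ ∀ a ∈ b, a < N) :
    (ascOne N k M).length = B ∧ ∀ c ∈ ascOne N k M, BlockOK N (2 ^ k) c := by
  obtain ⟨-, h2, h3⟩ := aChunks_facts N k B M hM hMv
  rw [← map_overlapAdd_aChunks, List.length_map]
  refine ⟨h2, fun c hc => ?_⟩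
  rw [List.mem_map] at hc
  obtain ⟨C, hC, rfl⟩ := hc
  obtain ⟨hCl, hCv⟩ := h3 C hC
  have hne : C ≠ [] := by intro h; rw [h] at hCl; have := Nat.two_pow_pos (k / 2); simp at hCl; omega
  have := blockOK_overlapAdd (N := N) (m := 2 ^ ((k + 1) / 2)) hN hne (fun b hb => hCv b hb)
  rwa [hCl, ← two_pow_split] at this

end Ascent

/-- **Validity and size of a descent** (for `N > 0`). [folklore] -/
theorem descOne_facts (hN : 0 < N) (k : ℕ) (Fb : List (List ℕ)) (hFb : ∀ b ∈ Fb, BlockOK N (2 ^ k) b) :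
    (descOne N k Fb).length = Fb.length * 2 ^ (k / 2) ∧
      ∀ c ∈ descOne N k Fb, c.length = 2 * 2 ^ ((k + 1) / 2) ∧ ∀ a ∈ c, a < N := by
  refine ⟨length_descOne k Fb, ?_⟩
  rw [← dLevel_last N k Fb]
  exact dLevel_valid N k Fb hN hFb _ le_rfl

/-- The block length after a descent is `2^{k'}` for the next exponent `k' = (k+1)/2 + 1`. [folklore] -/
theorem two_mul_two_pow_half (k : ℕ) : 2 * 2 ^ ((k + 1) / 2) = 2 ^ ((k + 1) / 2 + 1) := by rw [pow_succ]; ring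


/-! ### The schedule, the history and the ascent bookkeeping -/

/-- The coded twiddle history of one depth `(k, B)`, most recent level first. [folklore] -/
def twEnc (p : ℕ × ℕ) : List (List Bool) :=
  (twHist (2 ^ ((p.1 + 1) / 2)) (2 * 2 ^ ((p.1 + 1) / 2)) p.2 (p.1 / 2)).map encVec

/-- The schedule items (top first) after the descents from `k` onto `S`. [folklore] -/
def schedFin : ℕ → List (List Bool) → List (List Bool)
  | k, S => if k ≤ 3 then S else schedFin ((k + 1) / 2 + 1) (encodeNat k :: S)
  termination_by k => k
  decreasing_by omega

/-- The history items (top first) after the descents from `(k, B)` onto `H`. [folklore] -/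
def histFin : ℕ → ℕ → List (List Bool) → List (List Bool)
  | k, B, H => if k ≤ 3 then H else histFin ((k + 1) / 2 + 1) (B * 2 ^ (k / 2)) (twEnc (k, B) ++ H)
  termination_by k => k
  decreasing_by omega

/-- The history items of a list of depths (leaf-most first). [folklore] -/
def aHist (l : List (ℕ × ℕ)) : List (List Bool) := l.flatMap twEnc

/-- `schedFin` at `k ≤ 3`. [folklore] -/
theorem schedFin_of_le {k : ℕ} (hk : k ≤ 3) (S : List (List Bool)) : schedFin k S = S := by rw [schedFin, if_pos hk]

/-- `schedFin` at `k ≥ 4`. [folklore] -/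
theorem schedFin_of_gt {k : ℕ} (hk : 3 < k) (S : List (List Bool)) :
    schedFin k S = schedFin ((k + 1) / 2 + 1) (encodeNat k :: S) := by rw [schedFin, if_neg (by omega)]

/-- `histFin` at `k ≤ 3`. [folklore] -/
theorem histFin_of_le {k : ℕ} (hk : k ≤ 3) (B : ℕ) (H : List (List Bool)) : histFin k B H = H := by rw [histFin, if_pos hk]

/-- `histFin` at `k ≥ 4`. [folklore] -/
theorem histFin_of_gt {k : ℕ} (hk : 3 < k) (B : ℕ) (H : List (List Bool)) :
    histFin k B H = histFin ((k + 1) / 2 + 1) (B * 2 ^ (k / 2)) (twEnc (k, B) ++ H) := by rw [histFin, if_neg (by omega)]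

/-- **The schedule is the reversed exponent list.** [folklore] -/
theorem schedFin_eq (k : ℕ) : ∀ (B : ℕ) (S : List (List Bool)),
    schedFin k S = ((ditems k B).map fun p => encodeNat p.1).reverse ++ S := by
  induction k using Nat.strong_induction_on with
  | _ k ih =>
    intro B S
    by_cases hk : k ≤ 3
    · rw [schedFin_of_le hk, ditems_of_le hk]; rfl
    · rw [schedFin_of_gt (by omega), ditems_of_gt (by omega), ih _ (by omega) (B * 2 ^ (k / 2)), List.map_cons, List.reverse_cons,
        List.append_assoc]; rfl

/-- **The history is the depths' twiddle histories, leaf-most first.** [folklore] -/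
theorem histFin_eq (k : ℕ) : ∀ (B : ℕ) (H : List (List Bool)), histFin k B H = aHist (ditems k B).reverse ++ H := by
  induction k using Nat.strong_induction_on with
  | _ k ih =>
    intro B H
    by_cases hk : k ≤ 3
    · rw [histFin_of_le hk, ditems_of_le hk]; rfl
    · rw [histFin_of_gt (by omega), ditems_of_gt (by omega), ih _ (by omega), List.reverse_cons, aHist, aHist, List.flatMap_append,
        List.flatMap_cons, List.flatMap_nil, List.append_nil, List.append_assoc]

/-- The leaf batch: size and validity (for `N > 0`). [folklore] -/
theorem dAll_facts (hN : 0 < N) (k : ℕ) : ∀ (Fb : List (List ℕ)), (∀ b ∈ Fb, BlockOK N (2 ^ k) b) →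
    (dAll N k Fb).length = Bfin k Fb.length ∧ ∀ b ∈ dAll N k Fb, BlockOK N (2 ^ kfin k) b := by
  induction k using Nat.strong_induction_on with
  | _ k ih =>
    intro Fb hFb
    by_cases hk : k ≤ 3
    · rw [dAll_of_le N hk, Bfin_of_le hk, kfin_of_le hk]; exact ⟨rfl, hFb⟩
    · obtain ⟨hl, hv⟩ := descOne_facts N hN k Fb hFb
      rw [dAll_of_gt N (by omega), Bfin_of_gt (by omega), kfin_of_gt (by omega), ← hl]
      exact ih _ (by omega) _ fun b hb => by rw [← two_mul_two_pow_half]; exact hv b hb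

/-- Well-formedness of an ascent from the leaf list `M` along the depths `l` (leaf-most first):
at each depth the leaf list has the expected shape, whatever valid result the depth produces. [folklore] -/
def AscWF : List (ℕ × ℕ) → List (List ℕ) → Prop
  | [], _ => True
  | (k, B) :: rest, M => M.length = B * 2 ^ (k / 2) ∧ (∀ b ∈ M, b.length = 2 * 2 ^ ((k + 1) / 2) ∧ ∀ a ∈ b, a < N) ∧
      ∀ M' : List (List ℕ), M'.length = B → (∀ b ∈ M', BlockOK N (2 ^ k) b) → AscWF rest M'

/-- **The descents produce a well-formed ascent.** [folklore] -/
theorem ascWF_ditems (k : ℕ) : ∀ (B : ℕ) (M : List (List ℕ)) (rest : List (ℕ × ℕ)),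
    M.length = Bfin k B → (∀ b ∈ M, BlockOK N (2 ^ kfin k) b) →
    (∀ M' : List (List ℕ), M'.length = B → (∀ b ∈ M', BlockOK N (2 ^ k) b) → AscWF N rest M') →
    AscWF N ((ditems k B).reverse ++ rest) M := by
  induction k using Nat.strong_induction_on with
  | _ k ih =>
    intro B M rest hM hMv hcont
    by_cases hk : k ≤ 3
    · rw [ditems_of_le hk, List.reverse_nil, List.nil_append]
      rw [Bfin_of_le hk] at hM; rw [kfin_of_le hk] at hMv
      exact hcont M hM hMv
    · rw [ditems_of_gt (by omega), List.reverse_cons, List.append_assoc, List.singleton_append]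
      rw [Bfin_of_gt (by omega)] at hM; rw [kfin_of_gt (by omega)] at hMv
      refine ih _ (by omega) _ M _ hM hMv fun M' hM' hM'v => ⟨hM', fun b hb => ?_, hcont⟩
      have := hM'v b hb; rwa [← two_mul_two_pow_half] at this

/-- `AscWF` of a cons, unfolded. [folklore] -/
theorem ascWF_cons {k B : ℕ} {rest : List (ℕ × ℕ)} {M : List (List ℕ)} (h : AscWF N ((k, B) :: rest) M) :
    M.length = B * 2 ^ (k / 2) ∧ (∀ b ∈ M, b.length = 2 * 2 ^ ((k + 1) / 2) ∧ ∀ a ∈ b, a < N) ∧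
      ∀ M' : List (List ℕ), M'.length = B → (∀ b ∈ M', BlockOK N (2 ^ k) b) → AscWF N rest M' := h

/-- The unary coding of the descent test `k ∸ 3` as seen by the stream loop over the depths. [folklore] -/
def kdCode : List (ℕ × ℕ) → List Bool
  | [] => []
  | p :: _ => true :: List.replicate (p.1 - 4) true

/-- The test register codes the remaining depths. [folklore] -/
theorem kdCode_ditems (k B : ℕ) : kdCode (ditems k B) = List.replicate (k - 3) true := by
  by_cases hk : k ≤ 3
  · rw [ditems_of_le hk, kdCode, show k - 3 = 0 by omega, List.replicate_zero]
  · rw [ditems_of_gt (by omega), kdCode, show k - 3 = (k - 4) + 1 by omega, List.replicate_succ]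

/-- The leaf products: size and validity (for `N > 0`). [folklore] -/
theorem leaf_facts (hN : 0 < N) (k : ℕ) {Fb Gb : List (List ℕ)} (hFb : ∀ b ∈ Fb, BlockOK N (2 ^ k) b)
    (hGb : ∀ b ∈ Gb, BlockOK N (2 ^ k) b) (hBG : Gb.length = Fb.length) :
    (List.zipWith (negMul N (2 ^ kfin k)) (dAll N k Fb) (dAll N k Gb)).length = Bfin k Fb.length ∧
      ∀ b ∈ List.zipWith (negMul N (2 ^ kfin k)) (dAll N k Fb) (dAll N k Gb), BlockOK N (2 ^ kfin k) b := by
  obtain ⟨hlF, hvF⟩ := dAll_facts N hN k Fb hFb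
  obtain ⟨hlG, hvG⟩ := dAll_facts N hN k Gb hGb
  refine ⟨by rw [List.length_zipWith, hlF, hlG, hBG, min_self], fun b hb => ?_⟩
  obtain ⟨f, hf, g, hg, rfl⟩ := Com.exists_mem_of_mem_zipWith hb
  exact ⟨length_negMul f (hvG g hg).1, fun a ha => lt_of_mem_negMul hN f g ha⟩


end NegFFT

end Literature.Computability.Complexity
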